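import Summits.BirchSwinnertonDyer.BirchSwinnertonDyer.Theorems.ByReductionTypeAtTwoSupersingularFlatLocalInjectivity
import Literature.NumberTheory.EllipticCurves.Sprung2024.ChromaticCharValueRankZeroProofs
import Literature.NumberTheory.EllipticCurves.Sprung2012.ColemanMapSurjectiveProofs
import HarnessLib

/-!
# Sprung 2024 §5.2 for the colour ♭ over `ℚ` under EXPLICIT Honda clauses (any `p`): `Col♭` onto `Λ`,
# "`r_p` injective", and the ♭ `Γ`-Euler characteristic reduced to the single count of Lemma 5.5 —
# the `p = 2` port, part 3

Seat `bsd-2adic-ss-1` GEN 10, crux `SupersingularRankZeroAtTwo` (item stmt-BirchSwinnertonDyer-19097,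
route `ByReductionTypeAtTwo`, rung K4), line `signed_halves_two` v8 stub (5) `stub_pmFlatData`, conjunct
EC♭@2 ("for every ♭ dual datum `D`: `X♭` torsion ⇒ `char X♭ = (f)` ⇒ `Sel_{2^∞}(E/ℚ)` finite ⇒
`f(0) = u · 2^{ord₂ ∏ c_ℓ} · #Sel_{2^∞}(E/ℚ)`", i.e. F. Sprung, Adv. Math. 449 (2024) §5.2 Lemmas
5.5·5.8·5.9 READ AT 2). Parts 1–2: `…FlatColemanClauses.lean`, `…FlatLocalInjectivity.lean`.

WHAT IS PROVED (namespace `…Theorems.SSFlatEC`; `W/ℚ` elliptic and globally minimal, ANY prime `p`,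
ANY `ℤ_p`-extension `κ` with topological generator `γ`, the place `v ∋ p`, `ι = closureEmb ℚ_v`, a
local `g` restricting to a generator, `ap` with `p ∣ ap`, local points `c = (c_n)`; the Honda clauses
used are DISPLAYED one by one — levels `c_n ∈ E(ℚ_{p,n})`, the trace relation for `n ≥ 1`, the
level-`0` generation clause ON `c_0` (injective + `p`-saturated) — together with "no `p`-torsion in
`E(ℚ_∞·ℚ_p)`" (Sprung 2012 Lemma 2.3, printed for all `p` incl. `2`)):
* `exists_layer_zero_functional_not_dvd` — a functional of `E(ℚ_v)` with a value prime to `p`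
  (`E(ℚ_v) ≠ pE(ℚ_v)`, tree `Sprung2012.exists_point_forall_nsmul_ne`; body of
  `Sprung2012.exists_addMonoidHom_layer_zero_not_dvd` with `p ≠ 2 ↦` the displayed Lemma 2.3);
* `flat_surjective_rat` — **`Col♭` is onto `Λ`** (Sprung 2012 Prop. 7.3's conclusion) at ANY `p` from
  the clauses (at odd `p` the tree's `prop73_colemanFlat_surjective_holds` goes through `a_p − 2 ∈ ℤ_pˣ`;
  here through `c_0` directly — at `p = 2`, `c_0 = d_0 = [−c♭]ε` with `c♭ ∈ {1, −7}` a unit);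
* `mem_localKerOver_of_flat_rat` — **"`r_p` is injective"** for ♭ (Sprung 2024 L5.5 case `v = p`);
* `finite_flatKerG_rat` — `ker g = A♭_0/Sel_0` is finite;
* `flatCharValue_of_count` — **the ♭ `Γ`-Euler characteristic in rank `0`**,
  `f(0) = u · p^{ord_p ∏ c_ℓ} · #Sel_{p^∞}(E/ℚ)`, from the clauses, `#E[p^∞]^{Γ_ℚ} = 1` (displayed) and
  ONE displayed count — Lemma 5.5's `#ker g · #E(ℚ)_p = p^{ord_p ∏ c_ℓ} · #(Sel♭_∞)_Γ` (Greenberg LNM 1716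
  Lemmas 4.4 + 4.7 / Cassels–Poitou–Tate with `Sel ↦ Sel♭`; at `p = 2` this is where the real place of
  Kato's (14.9.3) «exact up to ×2 in the case `p = 2`» lives) — by the K3 lane's kernel Lemmas 5.8 × 5.9
  (`SharpFlatSelmerDualData.constantCoeff_charGenerator_mul_natCard_endCoinvariants_of_finite`, any `p`).
So at `p = 2` the EC♭ conjunct of the line is a THEOREM modulo {Honda₂ clauses on the supplied data,
Lemma 2.3 at `2`, `#E(ℚ)[2^∞] = 1` (tree: good supersingular at `2` ⇒ `E[2]` irreducible), the L5.5 count}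
— part 4 (`…FlatEulerCharTwo.lean`) discharges the torsion input and reshapes the line.
HONEST FRAMING: kernel theorems on the tree's transcription of Sprung's objects; displayed hypotheses;
nothing about any curve is asserted; no census cell moves; BSD is not proved by any of this. Proof
bodies adapted from the K3 lane's `p ≠ 2` files (credit: `bsd-ssimc-k3c5-kdot-split` g5–g7,
`bsd-cited-r18`, `bsd-littype-11`).

References: [Sprung2024] §5.2 pp. 39–41 (Lemmas 5.5–5.9, Proof of Thm. 5.3); [Sprung2012] Lemma 2.3,
Thm. 2.2 (2′) (p. 1487), Def. 7.2, Prop. 7.3, Lemmas 7.4–7.5 (p. 1500), Def. 7.9–7.11 (p. 1503);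
[GreenbergLNM1716] §4 Thm. 4.1, Lemmas 4.2–4.7; [MilneADT2006] I Lemma 3.3; [Kato2004] (14.9.3) p. 279.
-/

set_option autoImplicit false
-- the Theorems namespace of this sub repeats the summit name by design (D-0017 nested layout)
set_option linter.dupNamespace false

noncomputable section

open scoped Classical NumberField

open NumberField IsDedekindDomain Polynomial

universe u

namespace Summit.BirchSwinnertonDyer.BirchSwinnertonDyer.Theorems.SSFlatEC

open Literature.NumberTheory.EllipticCurves Literature.NumberTheory.GaloisRepresentations
  WeierstrassCurve ZpExtension Literature.NumberTheory.EllipticCurves.Kobayashi2003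
  Literature.NumberTheory.EllipticCurves.Sprung2017 Literature.NumberTheory.EllipticCurves.Sprung2012
  Literature.NumberTheory.EllipticCurves.Sprung2024 Literature.NumberTheory.EllipticCurves.IwasawaDual
  Literature.NumberTheory.EllipticCurves.IwasawaAlgebra

variable (W : WeierstrassCurve ℚ) [W.IsElliptic] [W.IsGloballyMinimal] (p : ℕ) [Fact p.Prime]
  {v : HeightOneSpectrum (𝓞 ℚ)}

/-! ## §1 A functional of `E(ℚ_v)` with a value prime to `p` -/

omit [W.IsGloballyMinimal] in
/-- **`Hom(E(ℚ_v), ℤ_p)` has an element with a value not divisible by `p`** (`v ∋ p`, ANY `p`), on the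
bottom layer `E(ℚ_0·ℚ_v) = E(ℚ_v)` of the tower (any `ℤ_p`-extension `κ`, any embedding `ι`), GIVEN that
`E(ℚ_∞·ℚ_p)` has no `p`-torsion (Lemma 2.3, displayed): `E(ℚ_v) ≠ pE(ℚ_v)`
(`Sprung2012.exists_point_forall_nsmul_ne`, Milne ADT I.3.3) + Galois descent + Pontryagin separation.
The body of `Sprung2012.exists_addMonoidHom_layer_zero_not_dvd` with `p ≠ 2` replaced by the displayed
Lemma 2.3. [cite: Sprung2012, proof of Prop. 7.3 (p. 1500) and Lemma 2.3 (p. 1487)] [cite: MilneADT2006, I Lemma 3.3] -/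
theorem exists_layer_zero_functional_not_dvd (κ : ZpExtension ℚ p) (hpv : (p : 𝓞 ℚ) ∈ v.asIdeal)
    (ι : AlgebraicClosure ℚ →ₐ[ℚ] AlgebraicClosure (v.adicCompletion ℚ))
    (hnt : ∀ P ∈ localTowerPointsOfEmb κ ι W, p • P = 0 → P = 0) :
    ∃ (z : localLayerPointsOfEmb κ ι W 0 →+ ℤ_[p]) (x : localLayerPointsOfEmb κ ι W 0),
      ¬ (p : ℤ_[p]) ∣ z x := by
  haveI : PerfectField (v.adicCompletion ℚ) := by
    haveI : CharZero (v.adicCompletion ℚ) :=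
      charZero_of_injective_algebraMap (algebraMap ℚ _).injective
    infer_instance
  obtain ⟨P₀, hP₀⟩ := exists_point_forall_nsmul_ne W p hpv
  set x : localPoints W (v.adicCompletion ℚ) :=
    (localPointsEquivBaseChange W (v.adicCompletion ℚ)).symm
      (WeierstrassCurve.toGeomPoints (W.baseChange (v.adicCompletion ℚ)) P₀) with hxdef
  have hex : localPointsEquivBaseChange W (v.adicCompletion ℚ) x =
      WeierstrassCurve.toGeomPoints (W.baseChange (v.adicCompletion ℚ)) P₀ := by
    rw [hxdef, AddEquiv.apply_symm_apply]
  have hx0 : x ∈ localLayerPointsOfEmb κ ι W 0 := by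
    rw [mem_localLayerPointsOfEmb_zero_iff]
    intro τ
    apply (localPointsEquivBaseChange W (v.adicCompletion ℚ)).injective
    rw [localPointsEquivBaseChange_smul, hex, WeierstrassCurve.smul_toGeomPoints]
  -- the bottom layer has no `p`-torsion
  have hN : ∀ y : localLayerPointsOfEmb κ ι W 0, p • y = 0 → y = 0 := fun y hy ↦ by
    apply Subtype.ext
    exact hnt _ (localLayerPointsOfEmb_le_localTowerPointsOfEmb κ ι W 0 y.2)
      (by rw [← AddSubgroupClass.coe_nsmul, hy]; rfl)
  -- `x ∉ p·E(ℚ_v)`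
  have hx : ∀ y : localLayerPointsOfEmb κ ι W 0, p ^ 1 • y ≠ ⟨x, hx0⟩ := by
    intro y hy
    rw [pow_one] at hy
    have hyfix : ∀ τ : Field.absoluteGaloisGroup (v.adicCompletion ℚ),
        τ • localPointsEquivBaseChange W (v.adicCompletion ℚ) (y : localPoints W (v.adicCompletion ℚ)) =
          localPointsEquivBaseChange W (v.adicCompletion ℚ) (y : localPoints W (v.adicCompletion ℚ)) :=
      fun τ ↦ by
        rw [← localPointsEquivBaseChange_smul, (mem_localLayerPointsOfEmb_zero_iff κ ι W _).mp y.2 τ]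
    obtain ⟨P₁, hP₁⟩ := WeierstrassCurve.exists_toGeomPoints_eq_of_forall_smul_eq
      (W.baseChange (v.adicCompletion ℚ)) hyfix
    apply hP₀ P₁
    apply WeierstrassCurve.toGeomPoints_injective (W.baseChange (v.adicCompletion ℚ))
    have hy' : p • (y : localPoints W (v.adicCompletion ℚ)) = x := by
      rw [← AddSubgroupClass.coe_nsmul, hy]
    rw [map_nsmul, hP₁, ← map_nsmul, hy', hex]
  obtain ⟨z, hz⟩ := Literature.Algebra.Module.exists_addMonoidHom_padicInt_not_dvd hN hx
  exact ⟨z, ⟨x, hx0⟩, by rwa [pow_one] at hz⟩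

/-! ## §2 `Col♭` onto `Λ` and "`r_p` injective" over `ℚ`, any `p` -/

omit [W.IsGloballyMinimal] in
/-- **`Col♭` is onto `Λ`** (Sprung 2012 Prop. 7.3's conclusion) over `ℚ` at ANY `p` with `p ∣ ap`, for
local points `c` with levels, the `n ≥ 1` trace relation and the level-`0` generation clause ON `c_0`,
given no `p`-torsion in `E(ℚ_∞·ℚ_p)` (Lemma 2.3): `z₀` with `p ∤ z₀(c_0)` (`exists_not_dvd_apply_czero` +
§1), its Coleman value (`exists_isColemanPair_of_trace`) has unit ♭-component (`L♭(0) = −z₀(c_0)`), then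
`Λ`-linearity. [cite: Sprung2012, Prop. 7.3 (p. 1500), Def. 7.2 (p. 1500), Def. 5.9 (p. 1495)] -/
theorem flat_surjective_rat (κ : ZpExtension ℚ p) (hpv : (p : 𝓞 ℚ) ∈ v.asIdeal)
    (ι : AlgebraicClosure ℚ →ₐ[ℚ] AlgebraicClosure (v.adicCompletion ℚ))
    (hnt : ∀ P ∈ localTowerPointsOfEmb κ ι W, p • P = 0 → P = 0)
    {ap : ℤ} (hap : (p : ℤ) ∣ ap) {g : Field.absoluteGaloisGroup (v.adicCompletion ℚ)}
    (hg : κ.IsTopGenerator (resGalOfEmb ι g)) {c : ℕ → localPoints W (v.adicCompletion ℚ)}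
    (hc : ∀ n, c n ∈ localLayerPointsOfEmb κ ι W n)
    (hTr : ∀ n, 1 ≤ n → localTraceOfEmb κ ι W n (n + 1) (c (n + 1)) = ap • c n - c (n - 1))
    (hinj : ∀ z₀ : localLayerPointsOfEmb κ ι W 0 →+ ℤ_[p],
      evalOn W (localLayerPointsOfEmb κ ι W 0) z₀ (c 0) = 0 → z₀ = 0)
    (hsat : ∀ a : ℤ_[p], (∃ z₀ : localLayerPointsOfEmb κ ι W 0 →+ ℤ_[p],
        evalOn W (localLayerPointsOfEmb κ ι W 0) z₀ (c 0) = p * a) →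
      ∃ y : localLayerPointsOfEmb κ ι W 0 →+ ℤ_[p], evalOn W (localLayerPointsOfEmb κ ι W 0) y (c 0) = a)
    (f : IwasawaAlgebra p) :
    ∃ (z : localTowerPointsOfEmb κ ι W →+ ℤ_[p]) (Ls : IwasawaAlgebra p), IsColemanPair κ ι W ap g c z Ls f := by
  obtain ⟨z₀, hz₀⟩ := exists_not_dvd_apply_czero κ ι W hnt (hc 0) hinj hsat
    (exists_layer_zero_functional_not_dvd W p κ hpv ι hnt)
  obtain ⟨Ls₀, Lf₀, h0⟩ := exists_isColemanPair_of_trace κ ι W hg hap hc hTr z₀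
  exact flat_surjective_of_isUnit hg hc h0 (isUnit_flat_of_not_dvd_apply h0 _ hz₀) f

omit [W.IsGloballyMinimal] in
/-- **"`r_p` is injective" for ♭ over `ℚ` at ANY `p`** (Sprung 2024 Lemma 5.5 case `v = p`, in the body
shape of `Sprung2024.lem55AllN_sharpFlat_localKerOver_of_layerToInfty_mem` at the tuple
`(W, p, κ, v, g, c, ♭)`): from the clauses, Lemma 2.3 (displayed) and the engine
`mem_localKerOver_of_layerToInfty_mem_flatLocalKummer` fed with `flat_surjective_rat`.
[cite: Sprung2024, §5.2 proof of Lemma 5.5, case v = p (p. 40)] [cite: Sprung2012, Prop. 7.3, Lemma 2.3] -/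
theorem mem_localKerOver_of_flat_rat (κ : ZpExtension ℚ p) (hpv : (p : 𝓞 ℚ) ∈ v.asIdeal)
    (hnt : ∀ P ∈ localTowerPointsOfEmb κ (closureEmb (K := ℚ) (v.adicCompletion ℚ)) W, p • P = 0 → P = 0)
    {ap : ℤ} (hap : (p : ℤ) ∣ ap) {g : Field.absoluteGaloisGroup (v.adicCompletion ℚ)}
    (hg : κ.IsTopGenerator (resGalOfEmb (closureEmb (K := ℚ) (v.adicCompletion ℚ)) g))
    {c : ℕ → localPoints W (v.adicCompletion ℚ)}
    (hc : ∀ n, c n ∈ localLayerPointsOfEmb κ (closureEmb (K := ℚ) (v.adicCompletion ℚ)) W n)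
    (hTr : ∀ n, 1 ≤ n → localTraceOfEmb κ (closureEmb (K := ℚ) (v.adicCompletion ℚ)) W n (n + 1)
      (c (n + 1)) = ap • c n - c (n - 1))
    (hinj : ∀ z₀ : localLayerPointsOfEmb κ (closureEmb (K := ℚ) (v.adicCompletion ℚ)) W 0 →+ ℤ_[p],
      evalOn W (localLayerPointsOfEmb κ (closureEmb (K := ℚ) (v.adicCompletion ℚ)) W 0) z₀ (c 0) = 0 →
        z₀ = 0)
    (hsat : ∀ a : ℤ_[p],
      (∃ z₀ : localLayerPointsOfEmb κ (closureEmb (K := ℚ) (v.adicCompletion ℚ)) W 0 →+ ℤ_[p],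
        evalOn W (localLayerPointsOfEmb κ (closureEmb (K := ℚ) (v.adicCompletion ℚ)) W 0) z₀ (c 0) =
          p * a) →
      ∃ y : localLayerPointsOfEmb κ (closureEmb (K := ℚ) (v.adicCompletion ℚ)) W 0 →+ ℤ_[p],
        evalOn W (localLayerPointsOfEmb κ (closureEmb (K := ℚ) (v.adicCompletion ℚ)) W 0) y (c 0) = a)
    (y : W.subgroupH1 p (κ.layerSubgroup 0))
    (hy : W.layerToInfty κ 0 y ∈ sharpFlatLocalKummerOverOfEmb W p κ.kerSubgroup
        (closureEmb (K := ℚ) (v.adicCompletion ℚ))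
        (localTowerPointsOfEmb κ (closureEmb (K := ℚ) (v.adicCompletion ℚ)) W)
        (colemanKer κ (closureEmb (K := ℚ) (v.adicCompletion ℚ)) W ap g c Chroma.flat)) :
    y ∈ W.localKerOver p (κ.layerSubgroup 0) (v.adicCompletion ℚ) :=
  mem_localKerOver_of_layerToInfty_mem_flatLocalKummer W κ (v.adicCompletion ℚ) hap hg hc hTr
    (flat_surjective_rat W p κ hpv _ hnt hap hg hc hTr hinj hsat) hnt hy

/-! ## §3 The ♭ `Γ`-Euler characteristic reduced to the count of Lemma 5.5, any `p` -/

/-- **Sprung 2024, Lemmas 5.8 × 5.9 over `ℚ` for ♭ under the explicit clauses, any `p`** — the body of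
`Sprung2024.constantCoeff_charGenerator_mul_natCard_sharpFlatEndCoinvariants_rat` with `p ≠ 2` replaced by
the displayed inputs it bought: `#E[p^∞]^{Γ_ℚ} = 1` (`htors`) and "`Ker Col♭` kills `E(ℚ_p)`" (from the
level-`0` generation clause on `c_0`, part 1). For every ♭ dual datum `D` with `X♭` finitely generated
torsion, `char X♭ = (f)`, `Sel_{p^∞}(E/ℚ)` finite and `ker g = A♭_0/Sel_0` finite: `Sel♭_∞^γ`, `(Sel♭_∞)_γ`
finite, `f(0) ≠ 0`, and `f(0) · #(Sel♭_∞)_γ = u · #Sel_{p^∞}(E/ℚ) · #(A♭_0/Sel_0)`.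
[cite: Sprung2024, §5.2 Lemmas 5.8, 5.9 and Proof of Thm. 5.3 (p. 41)] [cite: GreenbergLNM1716, §4 Thm. 4.1, Lemmas 4.2–4.3] -/
theorem constantCoeff_mul_natCard_flatEndCoinvariants_rat
    (κ : ZpExtension ℚ p) {γ : Field.absoluteGaloisGroup ℚ} (hγ : κ.IsTopGenerator γ)
    (v : HeightOneSpectrum (𝓞 ℚ)) {g : Field.absoluteGaloisGroup (v.adicCompletion ℚ)}
    {c : ℕ → localPoints W (v.adicCompletion ℚ)}
    (hc0 : c 0 ∈ localLayerPointsOfEmb κ (closureEmb (K := ℚ) (v.adicCompletion ℚ)) W 0)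
    (hinj : ∀ z₀ : localLayerPointsOfEmb κ (closureEmb (K := ℚ) (v.adicCompletion ℚ)) W 0 →+ ℤ_[p],
      evalOn W (localLayerPointsOfEmb κ (closureEmb (K := ℚ) (v.adicCompletion ℚ)) W 0) z₀ (c 0) = 0 →
        z₀ = 0)
    (htors : Nat.card (MulAction.fixedPoints (Field.absoluteGaloisGroup ℚ) (W.geomPrimaryTorsion p)) = 1)
    (D : SharpFlatSelmerDualData W κ γ (closureEmb (K := ℚ) (v.adicCompletion ℚ)) (W.frobeniusTrace p) g c Chroma.flat)
    [Module.Finite (IwasawaAlgebra p) D.X] (hX : Module.IsTorsion (IwasawaAlgebra p) D.X)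
    (f : IwasawaAlgebra p) (hf : D.charIdeal = Ideal.span {f})
    (hfin : Finite (W.selmerGroupPInfty p))
    (hkerg : Finite (↥((sharpFlatSelmerInfty W κ (closureEmb (K := ℚ) (v.adicCompletion ℚ))
        (W.frobeniusTrace p) g c Chroma.flat).comap (W.layerToInfty κ 0)) ⧸
      (W.selmerLayer κ 0).addSubgroupOf
        ((sharpFlatSelmerInfty W κ (closureEmb (K := ℚ) (v.adicCompletion ℚ))
          (W.frobeniusTrace p) g c Chroma.flat).comap (W.layerToInfty κ 0)))) :
    Finite ↥(endInvariants (conjSharpFlatSelmerInfty W κ (closureEmb (K := ℚ) (v.adicCompletion ℚ))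
        (W.frobeniusTrace p) g c Chroma.flat γ - 1)) ∧
      Finite (EndCoinvariants (conjSharpFlatSelmerInfty W κ (closureEmb (K := ℚ) (v.adicCompletion ℚ))
        (W.frobeniusTrace p) g c Chroma.flat γ - 1)) ∧
      PowerSeries.constantCoeff f ≠ 0 ∧
      ∃ u : ℤ_[p]ˣ,
        PowerSeries.constantCoeff f *
            (Nat.card (EndCoinvariants (conjSharpFlatSelmerInfty W κ
              (closureEmb (K := ℚ) (v.adicCompletion ℚ)) (W.frobeniusTrace p) g c Chroma.flat γ - 1)) : ℤ_[p]) =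
          u * Nat.card ↥(W.selmerGroupPInfty p) *
            Nat.card (↥((sharpFlatSelmerInfty W κ (closureEmb (K := ℚ) (v.adicCompletion ℚ))
                (W.frobeniusTrace p) g c Chroma.flat).comap (W.layerToInfty κ 0)) ⧸
              (W.selmerLayer κ 0).addSubgroupOf
                ((sharpFlatSelmerInfty W κ (closureEmb (K := ℚ) (v.adicCompletion ℚ))
                  (W.frobeniusTrace p) g c Chroma.flat).comap (W.layerToInfty κ 0))) := by
  -- `E(ℚ_∞)[p^∞]` is finite
  haveI := W.finite_fixedPoints_kerSubgroup_geomPrimaryTorsion_rat κ (p := p)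
  -- the control map `Sel_0 → Sel♭_∞` exists (`Ker Col♭ ⊥ E(ℚ_p)`)
  have hSel : W.selmerLayer κ 0 ≤ (sharpFlatSelmerInfty W κ (closureEmb (K := ℚ) (v.adicCompletion ℚ))
      (W.frobeniusTrace p) g c Chroma.flat).comap (W.layerToInfty κ 0) := fun y hy ↦
    AddSubgroup.mem_comap.mpr (layerToInfty_mem_sharpFlatSelmerInfty_of_mem_selmerLayer_zero W κ v
      (fun z hz x hx ↦ apply_layer_zero_eq_zero_of_mem_colemanKer_flat hc0 hinj hz hx) hy)
  obtain ⟨h0, h1, hf0, u, hu⟩ :=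
    D.constantCoeff_charGenerator_mul_natCard_endCoinvariants_of_finite hγ hX f hf hSel hfin hkerg
  refine ⟨h0, h1, hf0, u, ?_⟩
  rw [htors, Nat.cast_one, mul_one] at hu
  exact hu

/-- **The ♭ `Γ`-Euler characteristic in analytic rank `0` from ONE displayed count** (Sprung 2024 §5.2
"Proof of Theorem 5.3", p. 41, as a kernel computation at ANY `p`): for `W/ℚ`, `p ∣ a_p`, the cyclotomic-type
data `(κ, γ)`, `v ∋ p`, a local lift `g`, local points `c` with levels, the `n ≥ 1` trace relation and
the level-`0` generation clause on `c_0`, no `p`-torsion in `E(ℚ_∞·ℚ_p)` (Lemma 2.3), `#E[p^∞]^{Γ_ℚ} = 1`,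
and THE COUNT of Lemma 5.5 at the tuple (`hcount`: `Sel_{p^∞}(E/ℚ)` finite → `(Sel♭_∞)_γ` finite →
`#(A♭_0/Sel_0) · #E[p^∞]^{Γ_ℚ} = p^{ord_p ∏ c_ℓ} · #(Sel♭_∞)_γ`; Greenberg LNM 1716 Lemmas 4.4 + 4.7 with
`Sel ↦ Sel♭` — NOT proved here): for every ♭ dual datum `D` with `X♭` finitely generated torsion,
`char X♭ = (f)` and `Sel_{p^∞}(E/ℚ)` finite, `f(0) = u · p^{ord_p ∏ c_ℓ} · #Sel_{p^∞}(E/ℚ)`, `u ∈ ℤ_pˣ` —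
the conclusion in the `ℚ_p`-spelling of `Sprung2024.lem59AllN_sharpFlatCharValue_rankZero` / of the line's
EC♭ clause. "`r_p` injective" (`mem_localKerOver_of_flat_rat`) makes `ker g` finite; Lemmas 5.8 × 5.9
(`constantCoeff_mul_natCard_flatEndCoinvariants_rat`); cancel `#(Sel♭_∞)_γ ≠ 0`.
[cite: Sprung2024, §5.2 Proof of Thm. 5.3 (p. 41) and Lemmas 5.5, 5.8, 5.9] [cite: GreenbergLNM1716, §4 Lemmas 4.4, 4.7] -/
theorem flatCharValue_of_count (κ : ZpExtension ℚ p) {γ : Field.absoluteGaloisGroup ℚ}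
    (hγ : κ.IsTopGenerator γ) (hpv : (p : 𝓞 ℚ) ∈ v.asIdeal)
    (hnt : ∀ P ∈ localTowerPointsOfEmb κ (closureEmb (K := ℚ) (v.adicCompletion ℚ)) W, p • P = 0 → P = 0)
    (hap : (p : ℤ) ∣ W.frobeniusTrace p) {g : Field.absoluteGaloisGroup (v.adicCompletion ℚ)}
    (hg : κ.IsTopGenerator (resGalOfEmb (closureEmb (K := ℚ) (v.adicCompletion ℚ)) g))
    {c : ℕ → localPoints W (v.adicCompletion ℚ)}
    (hc : ∀ n, c n ∈ localLayerPointsOfEmb κ (closureEmb (K := ℚ) (v.adicCompletion ℚ)) W n)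
    (hTr : ∀ n, 1 ≤ n → localTraceOfEmb κ (closureEmb (K := ℚ) (v.adicCompletion ℚ)) W n (n + 1)
      (c (n + 1)) = W.frobeniusTrace p • c n - c (n - 1))
    (hinj : ∀ z₀ : localLayerPointsOfEmb κ (closureEmb (K := ℚ) (v.adicCompletion ℚ)) W 0 →+ ℤ_[p],
      evalOn W (localLayerPointsOfEmb κ (closureEmb (K := ℚ) (v.adicCompletion ℚ)) W 0) z₀ (c 0) = 0 →
        z₀ = 0)
    (hsat : ∀ a : ℤ_[p],
      (∃ z₀ : localLayerPointsOfEmb κ (closureEmb (K := ℚ) (v.adicCompletion ℚ)) W 0 →+ ℤ_[p],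
        evalOn W (localLayerPointsOfEmb κ (closureEmb (K := ℚ) (v.adicCompletion ℚ)) W 0) z₀ (c 0) =
          p * a) →
      ∃ y : localLayerPointsOfEmb κ (closureEmb (K := ℚ) (v.adicCompletion ℚ)) W 0 →+ ℤ_[p],
        evalOn W (localLayerPointsOfEmb κ (closureEmb (K := ℚ) (v.adicCompletion ℚ)) W 0) y (c 0) = a)
    (htors : Nat.card (MulAction.fixedPoints (Field.absoluteGaloisGroup ℚ) (W.geomPrimaryTorsion p)) = 1)
    (hcount : Finite (W.selmerGroupPInfty p) →
      Finite (EndCoinvariants (conjSharpFlatSelmerInfty W κ (closureEmb (K := ℚ) (v.adicCompletion ℚ))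
        (W.frobeniusTrace p) g c Chroma.flat γ - 1)) →
      Nat.card (↥((sharpFlatSelmerInfty W κ (closureEmb (K := ℚ) (v.adicCompletion ℚ))
            (W.frobeniusTrace p) g c Chroma.flat).comap (W.layerToInfty κ 0)) ⧸
          (W.selmerLayer κ 0).addSubgroupOf
            ((sharpFlatSelmerInfty W κ (closureEmb (K := ℚ) (v.adicCompletion ℚ))
              (W.frobeniusTrace p) g c Chroma.flat).comap (W.layerToInfty κ 0))) *
        Nat.card (MulAction.fixedPoints (Field.absoluteGaloisGroup ℚ) (W.geomPrimaryTorsion p)) =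
      p ^ (padicValNat p W.tamagawaProduct) *
        Nat.card (EndCoinvariants (conjSharpFlatSelmerInfty W κ
          (closureEmb (K := ℚ) (v.adicCompletion ℚ)) (W.frobeniusTrace p) g c Chroma.flat γ - 1)))
    (D : SharpFlatSelmerDualData W κ γ (closureEmb (K := ℚ) (v.adicCompletion ℚ)) (W.frobeniusTrace p) g c Chroma.flat)
    [Module.Finite (IwasawaAlgebra p) D.X] (hX : Module.IsTorsion (IwasawaAlgebra p) D.X)
    (f : IwasawaAlgebra p) (hf : D.charIdeal = Ideal.span {f}) (hfin : Finite (W.selmerGroupPInfty p)) :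
    ∃ u : ℤ_[p]ˣ,
      ((PowerSeries.constantCoeff f : ℤ_[p]) : ℚ_[p]) =
        ((u : ℤ_[p]) : ℚ_[p]) * (p : ℚ_[p]) ^ (padicValNat p W.tamagawaProduct) *
          (Nat.card (W.selmerGroupPInfty p) : ℚ_[p]) := by
  -- `ker g = A♭_0/Sel_0` is finite ("`r_p` is injective")
  have hkerg := finite_sharpFlatKerG_of_localKerOver_of_layerToInfty_mem W p κ v hpv g c Chroma.flat
    (fun y hy ↦ mem_localKerOver_of_flat_rat W p κ hpv hnt hap hg hc hTr hinj hsat y hy)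
  -- Lemmas 5.8 × 5.9 (kernel)
  obtain ⟨-, hco, -, u, hu⟩ := constantCoeff_mul_natCard_flatEndCoinvariants_rat W p κ hγ v (hc 0) hinj
    htors D hX f hf hfin hkerg
  -- the count (displayed), with `#E[p^∞]^{Γ_ℚ} = 1`
  have h5 := hcount hfin hco
  rw [htors, mul_one] at h5
  -- cancel `#(Sel♭_∞)_γ ≠ 0` in `ℤ_p`
  set m := Nat.card (EndCoinvariants (conjSharpFlatSelmerInfty W κ
    (closureEmb (K := ℚ) (v.adicCompletion ℚ)) (W.frobeniusTrace p) g c Chroma.flat γ - 1)) with hm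
  haveI := hco
  have hm0 : (m : ℤ_[p]) ≠ 0 := by exact_mod_cast (Nat.card_pos (α := EndCoinvariants
    (conjSharpFlatSelmerInfty W κ (closureEmb (K := ℚ) (v.adicCompletion ℚ)) (W.frobeniusTrace p) g c
      Chroma.flat γ - 1))).ne'
  have h5' : (Nat.card (↥((sharpFlatSelmerInfty W κ (closureEmb (K := ℚ) (v.adicCompletion ℚ))
      (W.frobeniusTrace p) g c Chroma.flat).comap (W.layerToInfty κ 0)) ⧸ (W.selmerLayer κ 0).addSubgroupOf
        ((sharpFlatSelmerInfty W κ (closureEmb (K := ℚ) (v.adicCompletion ℚ)) (W.frobeniusTrace p) g c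
          Chroma.flat).comap (W.layerToInfty κ 0))) : ℤ_[p]) =
      (p : ℤ_[p]) ^ padicValNat p W.tamagawaProduct * (m : ℤ_[p]) := by
    exact_mod_cast h5
  rw [h5'] at hu
  have key : PowerSeries.constantCoeff f =
      (u : ℤ_[p]) * (p : ℤ_[p]) ^ padicValNat p W.tamagawaProduct * Nat.card (W.selmerGroupPInfty p) := by
    apply mul_right_cancel₀ hm0
    rw [hu]
    ring
  refine ⟨u, ?_⟩
  rw [key]
  push_cast
  ring

end Summit.BirchSwinnertonDyer.BirchSwinnertonDyer.Theorems.SSFlatEC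

end
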